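import Summits.ABC.IUTFork.Cor312LicenceExactOrdersMGenuine
import Literature.IUT.LogVolume.PilotSlotResidue
import HarnessLib

/-!
# [IUTchIII] Cor. 3.12, Step (xi-f): RATIONAL `j`-INVARIANT (`F_mod = ℚ`) ⟹ singleton fibres ⟹ the licence at the M-LEVEL
# setting of record is DECIDED EXACTLY by the integer orders predicates (the hypothesis of part 2 DISCHARGED for such data)

PROOF-ONLY record file (D-0012; no definitions, no `Prop` facts, no instances) of the abc-iut cell (WAVE-5 prover seat
abc-iut-w5-d166, gen 7; D-0079 R-W lane U, row «W:M-U2-ORDERS», part 4 over `Cor312LicenceExactOrdersMSingleton` (p467742) /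
`…MGenuine` (p467871)). TAKES NO SIDE on [IUTchIII] Cor. 3.12 (kurims manuscript p. 173–174; Step (xi-f) p. 184) or on any author.

THE POINT. Parts 2–3 decide the M-setting licence EXACTLY under the hypothesis «every fibre of `V̲` over a rational prime is a
singleton», left to the consumer. Here it is DISCHARGED for the data of the R-W WINDOW-TABLE's genuine rows: initial Θ-data on a curve
with RATIONAL `j`-invariant. `F_mod := ℚ(j_E) ⊆ F` (abc-iut-L5-t2's design choice, [IUTchI] Def. 3.1 (b)), so `j_E ∈ ℚ ⟹ [F_mod : ℚ] = 1`
⟹ ONE place of `F_mod` over each prime (`Σ_{v|p} n_v = [F_mod:ℚ]`, abc-iut-S2 `PilotData.card_placesOver_le_finrank`) ⟹ ONE member of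
`V̲` over each rational prime (`V̲ ⥲ V_mod` is injective, `underline_placeModOfM`).

* §1 **`fibre_eq_of_finrank_fieldOfModuli_eq_one`** / **`fibre_eq_of_j_mem_range`** — `[F_mod:ℚ] = 1` (resp. `j_E ∈ ℚ`) ⟹
  `∀ u, ∀ x y ∈ V̲_u, x = y`;
* §2 **`licence_settingPrVolSharpM_iff_orders_of_finrank_eq_one`** — generic ideles: part 2's exact decider with the singleton
  hypothesis replaced by `[F_mod:ℚ] = 1`;
* §3 **`licence_settingPrVolSharpM_tOfIdeleData_iff_orders_of_finrank_eq_one`** / **`…_of_j_mem_range`** — the datum's OWN ideles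
  (`M = (i+1)²·m_q`): for initial Θ-data with rational `j`-invariant, `Licence` at the own-ideles M setting — the `hSHw` / `hNumOffBad_M`
  clause of abc-iut-C-cert-3's M-line certificates for the q-pinned reading — holds **iff**
  `∀ u i, e_u·(((i+1)²·m_q(u) − (i+1)·D_u − (i+2)·R_in(u)) / e_u) + (i+2)·R_out(u) ≤ m_q(u)`, the inputs per prime being the local type
  `(e, D, R_in, R_out)` of the ONE completion `K_{v̲(u)}` and the one integer `m_q(u)` (`‖t_{q,v̲(u)}‖ = ‖ϖ_u‖^{m_q(u)}`).

HONEST SCOPE: nothing here asserts that initial Θ-data with rational `j` exist at any given triple (that is the apex seats' input,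
[IUTchIV] Cor. 2.2 (ii) (P1)–(P7)); the licence is a STRONGER-THAN-PRINT set-level reading of Step (xi-f) (ADJUDICATION-SPEC §2 (G1′));
OUR sharp containers and typed (Ind1)/(Ind2)/(Ind3); inhabited-as-typed ≠ true-in-print, refuted-as-typed ≠ refuted-in-print; nothing about
the printed GLOBAL inequality or the NUMBER-level `Cor22.Cor312AtDatum`; no side taken. [cite: Mochizuki2012, IUTchIII Cor. 3.12 p. 173–174,
Step (xi-f) p. 184; IUTchI Def. 3.1 (b)(e) p. 61–62; IUTchIV Prop. 1.2 (i)(ii) p. 10] [cite: DupuyHilado2025, §3.4, §3.6, §4.9, §4.12]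
[cite: NeukirchANT1999, Ch. I (8.2), Ch. II (5.5)] [claim: Mochizuki2012, status: disputed] for every IUT sentence quoted.
typed ≠ proved (these: proved); instantiated ≠ endorsed.
-/

noncomputable section

open Set Function NumberField IsDedekindDomain
open scoped Pointwise

namespace Summit.ABC.IUTFork.Thm311.Real

open Cor312 Cor312Vol Literature.IUT.LogThetaLattice Literature.IUT.LogVolume Literature.IUT.HodgeTheaters
  Literature.NumberTheory.NumberFields Literature.NumberTheory.GaloisRepresentations.Ultrametric

/-! ## §1. `[F_mod : ℚ] = 1` ⟹ one member of `V̲` over each rational prime -/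

section Fibre

variable {F K Fbar : Type} [Field F] [NumberField F] [Field K] [NumberField K] [Algebra F K]
  [Field Fbar] [Algebra F Fbar] [Algebra K Fbar] {E : WeierstrassCurve F} [E.IsElliptic] {l : ℕ}
  {Pb : BadPlacePredicates K} (D : InitialThetaData F K Fbar E l Pb)

/-- **`[F_mod:ℚ] = 1` ⟹ the fibre of `V̲` over a rational prime is a singleton**: both members lie over places of `F_mod` over `p_u`
(`placeModOfM_mem_placesOver`), of which there is at most `[F_mod:ℚ] = 1` (abc-iut-S2 `PilotData.card_placesOver_le_finrank`), and
`V̲ ⥲ V_mod` is injective (`underline_placeModOfM`). [cite: Mochizuki2012, IUTchI Def. 3.1 (b)(e) p. 61–62] [cite: NeukirchANT1999, Ch. I (8.2)] -/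
theorem fibre_eq_of_finrank_fieldOfModuli_eq_one (hF : Module.finrank ℚ (fieldOfModuli E) = 1) (u : FinitePlace ℚ)
    (x y : (thetaIndexOfInitial D).Fibre (Val.non u)) : x = y := by
  have hx := placeModOfM_mem_placesOver D (ratChar u) u (natCast_ratChar_mem u) x
  have hy := placeModOfM_mem_placesOver D (ratChar u) u (natCast_ratChar_mem u) y
  have hcard : (placesOver (fieldOfModuli E) (ratChar u)).card ≤ 1 :=
    (PilotData.card_placesOver_le_finrank (F := fieldOfModuli E) (ratChar u)).trans hF.le
  have heq : placeModOfM D u x = placeModOfM D u y := Finset.card_le_one.mp hcard _ hx _ hy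
  have hval : (Subtype.val (Subtype.val x) : Val K) = Subtype.val (Subtype.val y) := by
    rw [← underline_placeModOfM D u x, ← underline_placeModOfM D u y, heq]
  exact Subtype.ext (Subtype.ext hval)

/-- **`j_E ∈ ℚ` ⟹ the fibre of `V̲` over a rational prime is a singleton** (`F_mod = ℚ(j_E) = ℚ`, so `[F_mod:ℚ] = 1` — the three-line
argument of `InitialThetaData.finrank_fieldOfModuli_eq_one_of_j_mem_range` (`LDHInitialThetaDataPerPrime`), re-derived inline to keep
this file's import closure inside the M line). [cite: Mochizuki2012, IUTchI Def. 3.1 (b)(e) p. 61–62] -/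
theorem fibre_eq_of_j_mem_range (hj : E.j ∈ Set.range (algebraMap ℚ F)) (u : FinitePlace ℚ)
    (x y : (thetaIndexOfInitial D).Fibre (Val.non u)) : x = y := by
  refine fibre_eq_of_finrank_fieldOfModuli_eq_one D ?_ u x y
  rw [IntermediateField.finrank_eq_one_iff, fieldOfModuli, IntermediateField.adjoin_simple_eq_bot_iff,
    IntermediateField.mem_bot]
  exact hj

end Fibre

/-! ## §2. Generic ideles: the exact decider at `[F_mod:ℚ] = 1` -/

section Generic

variable {F K Fbar : Type} [Field F] [NumberField F] [Field K] [NumberField K] [Algebra F K]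
  [Field Fbar] [Algebra F Fbar] [Algebra K Fbar] {E : WeierstrassCurve F} [E.IsElliptic] {l : ℕ}
  {Pb : BadPlacePredicates K} (D : InitialThetaData F K Fbar E l Pb) {logvK : PadicLogsVal K}
  (hlog : LogvAnalyticVal logvK)
  (t : ∀ (u : FinitePlace ℚ) (_ : Fin (thetaIndexOfInitial D).lstar) (x : (thetaIndexOfInitial D).Fibre (Val.non u)),
    kOfM D (ratChar u) u (natCast_ratChar_mem u) x)
  (tq : ∀ (u : FinitePlace ℚ) (x : (thetaIndexOfInitial D).Fibre (Val.non u)),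
    kOfM D (ratChar u) u (natCast_ratChar_mem u) x)
  (M : Type) [Field M] [NumberField M]
  (archPk : ∀ (j : (thetaIndexOfInitial D).Label) (vQ : (thetaIndexOfInitial D).VQ),
    Set ((logShellsOfInitialDH D logvK).Packet j vQ))
  (archSub : ∀ (j : (thetaIndexOfInitial D).Label) (v : (thetaIndexOfInitial D).V),
    Set ((logShellsOfInitialDH D logvK).Packet j ((thetaIndexOfInitial D).over v)))
  (Ψ : ℤ → ∀ v : (thetaIndexOfInitial D).V, v ∈ (thetaIndexOfInitial D).Vbad →
    Set ((logShellsOfInitialDH D logvK).StarPacket v))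
  (act : ℤ → ∀ v : (thetaIndexOfInitial D).V, v ∈ (thetaIndexOfInitial D).Vbad →
    (logShellsOfInitialDH D logvK).StarPacket v → Module.End ℚ ((logShellsOfInitialDH D logvK).StarPacket v))
  (Mmod : ℤ → ∀ j : (thetaIndexOfInitial D).LabelStar, Set ((logShellsOfInitialDH D logvK).GlobalPacket j.1))
  (region : ℤ → ∀ j : (thetaIndexOfInitial D).LabelStar, FinDivisor M → ∀ vQ : (thetaIndexOfInitial D).VQ,
    Set ((logShellsOfInitialDH D logvK).Packet j.1 vQ))
  (n : ℤ) {HT : Type} {LogLink : HT → HT → Type} {IsFull : ∀ {s t : HT}, LogLink s t → Prop}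
  (lat : LGPGaussianLogThetaLattice LogLink IsFull)
  {Frd : Type} {IsoF : Frd → Frd → Type} {Ob : Frd → Type} {realify : Frd → Frd} {Strip : Type}
  {IsoS : Strip → Strip → Type}
  {Mv : ∀ v : (thetaIndexOfInitial D).V, v ∈ (thetaIndexOfInitial D).Vbad → Type} [∀ v h, Monoid (Mv v h)]
  (sig : GlobalLGPFrobenioidSignature (thetaIndexOfInitial D).lstar (thetaIndexOfInitial D).V
    (· ∈ (thetaIndexOfInitial D).Vbad) Frd IsoF Ob realify Strip IsoS Mv)
  (split : SplittingMonoids Mv) {ObΔ : Type}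
  {N : ∀ v : (thetaIndexOfInitial D).V, v ∈ (thetaIndexOfInitial D).Vbad → Type} [∀ v h, Monoid (N v h)]
  (qData : QPilotData ObΔ N)
  (htq0 : ∀ u x, tq u x ≠ 0) (Sq : Finset (FinitePlace ℚ))
  (htq1 : ∀ (u : FinitePlace ℚ) (x : (thetaIndexOfInitial D).Fibre (Val.non u)), u ∉ Sq → ‖tq u x‖ = 1)

/-- **`[F_mod:ℚ] = 1`: THE (xi-f) LICENCE AT THE M SETTING ⟺ THE ORDERS PREDICATES** (part 2's
`licence_settingPrVolSharpM_iff_orders_of_forall_eq` with the singleton hypothesis discharged by §1). Non-zero Θ-ideles; a member `x₀(u)` of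
`V̲` over every `u` with uniformiser `ϖ_u`, `d = D_u/e_u`, radius witnesses `‖cin(u)‖ = ‖ϖ_u‖^{R_in(u)}`, `‖cout(u)‖ = ‖ϖ_u‖^{R_out(u)}`, and integer
norms `‖t_{Θ,i,x₀(u)}‖ = ‖ϖ_u‖^{M(u,i)}`, `‖t_{q,x₀(u)}‖ = ‖ϖ_u‖^{m_q(u)}`:
`Licence ⟺ ∀ u i, e_u·((M(u,i) − (i+1)·D_u − (i+2)·R_in(u)) / e_u) + (i+2)·R_out(u) ≤ m_q(u)`.
[cite: Mochizuki2012, IUTchIII Cor. 3.12 p. 173–174, Step (xi-f) p. 184; IUTchI Def. 3.1 (b)(e) p. 61–62] [cite: DupuyHilado2025, §4.9, §4.12] -/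
theorem licence_settingPrVolSharpM_iff_orders_of_finrank_eq_one (ht0 : ∀ u i x, t u i x ≠ 0)
    (hF : Module.finrank ℚ (fieldOfModuli E) = 1)
    (x₀ : ∀ u : FinitePlace ℚ, (thetaIndexOfInitial D).Fibre (Val.non u))
    (ϖ : ∀ u : FinitePlace ℚ, (kOfM D (ratChar u) u (natCast_ratChar_mem u) (x₀ u))ˣ) (hϖ : ∀ u, IsUniformizer (ϖ u))
    (Dx : FinitePlace ℚ → ℕ)
    (hD : ∀ u, differentOrd (ratChar u) (kOfM D (ratChar u) u (natCast_ratChar_mem u) (x₀ u)) =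
      (Dx u : ℝ) / absRamificationIdx (ratChar u) (kOfM D (ratChar u) u (natCast_ratChar_mem u) (x₀ u)))
    (cin cout : ∀ u : FinitePlace ℚ, kOfM D (ratChar u) u (natCast_ratChar_mem u) (x₀ u))
    (hin : ∀ u (o : kOfM D (ratChar u) u (natCast_ratChar_mem u) (x₀ u)), ‖o‖ ≤ 1 →
      cin u * o ∈ logUnits (kOfM D (ratChar u) u (natCast_ratChar_mem u) (x₀ u)))
    (hmax : ∀ u, ∃ (ϖ' : (kOfM D (ratChar u) u (natCast_ratChar_mem u) (x₀ u))ˣ)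
      (w : kOfM D (ratChar u) u (natCast_ratChar_mem u) (x₀ u)),
      IsUniformizer ϖ' ∧ w ∉ logUnits (kOfM D (ratChar u) u (natCast_ratChar_mem u) (x₀ u)) ∧
        ‖w‖ * ‖(ϖ' : kOfM D (ratChar u) u (natCast_ratChar_mem u) (x₀ u))‖ ≤ ‖cin u‖)
    (houtΛ : ∀ u, cout u ∈ logUnits (kOfM D (ratChar u) u (natCast_ratChar_mem u) (x₀ u)))
    (hdom : ∀ u, ∀ z ∈ logUnits (kOfM D (ratChar u) u (natCast_ratChar_mem u) (x₀ u)), ‖z‖ ≤ ‖cout u‖)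
    (Rin Rout : FinitePlace ℚ → ℤ)
    (hRin : ∀ u, ‖cin u‖ = ‖(ϖ u : kOfM D (ratChar u) u (natCast_ratChar_mem u) (x₀ u))‖ ^ Rin u)
    (hRout : ∀ u, ‖cout u‖ = ‖(ϖ u : kOfM D (ratChar u) u (natCast_ratChar_mem u) (x₀ u))‖ ^ Rout u)
    (Mx : FinitePlace ℚ → Fin (thetaIndexOfInitial D).lstar → ℤ) (mq : FinitePlace ℚ → ℤ)
    (hΘ : ∀ u i, ‖t u i (x₀ u)‖ = ‖(ϖ u : kOfM D (ratChar u) u (natCast_ratChar_mem u) (x₀ u))‖ ^ Mx u i)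
    (hq : ∀ u, ‖tq u (x₀ u)‖ = ‖(ϖ u : kOfM D (ratChar u) u (natCast_ratChar_mem u) (x₀ u))‖ ^ mq u) :
    Thm311ToCor312.Licence
        (settingPrVolSharpM D hlog t tq M archPk archSub Ψ act Mmod region n lat sig split qData htq0 Sq htq1) ↔
      ∀ (u : FinitePlace ℚ) (i : Fin (thetaIndexOfInitial D).lstar),
        (absRamificationIdx (ratChar u) (kOfM D (ratChar u) u (natCast_ratChar_mem u) (x₀ u)) : ℤ) *
            ((Mx u i - ((i : ℕ) + 1 : ℕ) * (Dx u : ℤ) - ((i : ℕ) + 2 : ℕ) * Rin u) /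
              (absRamificationIdx (ratChar u) (kOfM D (ratChar u) u (natCast_ratChar_mem u) (x₀ u)) : ℤ)) +
          ((i : ℕ) + 2 : ℕ) * Rout u ≤ mq u :=
  licence_settingPrVolSharpM_iff_orders_of_forall_eq D hlog t tq M archPk archSub Ψ act Mmod region n lat sig split qData htq0 Sq
    htq1 ht0 x₀ (fun u x => fibre_eq_of_finrank_fieldOfModuli_eq_one D hF u x (x₀ u)) ϖ hϖ Dx hD cin cout hin hmax houtΛ hdom Rin
    Rout hRin hRout Mx mq hΘ hq

end Generic

/-! ## §3. The datum's own ideles: rational `j`-invariant -/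

section Own

variable {F K Fbar : Type} [Field F] [NumberField F] [Field K] [NumberField K] [Algebra F K]
  [Field Fbar] [Algebra F Fbar] [Algebra K Fbar] {E : WeierstrassCurve F} [E.IsElliptic] {l : ℕ}
  {Pb : BadPlacePredicates K} (D : InitialThetaData F K Fbar E l Pb) {logvK : PadicLogsVal K}
  (hlog : LogvAnalyticVal logvK) (r : ThetaData.IdeleData D)
  (M : Type) [Field M] [NumberField M]
  (archPk : ∀ (j : (thetaIndexOfInitial D).Label) (vQ : (thetaIndexOfInitial D).VQ),
    Set ((logShellsOfInitialDH D logvK).Packet j vQ))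
  (archSub : ∀ (j : (thetaIndexOfInitial D).Label) (v : (thetaIndexOfInitial D).V),
    Set ((logShellsOfInitialDH D logvK).Packet j ((thetaIndexOfInitial D).over v)))
  (Ψ : ℤ → ∀ v : (thetaIndexOfInitial D).V, v ∈ (thetaIndexOfInitial D).Vbad →
    Set ((logShellsOfInitialDH D logvK).StarPacket v))
  (act : ℤ → ∀ v : (thetaIndexOfInitial D).V, v ∈ (thetaIndexOfInitial D).Vbad →
    (logShellsOfInitialDH D logvK).StarPacket v → Module.End ℚ ((logShellsOfInitialDH D logvK).StarPacket v))
  (Mmod : ℤ → ∀ j : (thetaIndexOfInitial D).LabelStar, Set ((logShellsOfInitialDH D logvK).GlobalPacket j.1))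
  (region : ℤ → ∀ j : (thetaIndexOfInitial D).LabelStar, FinDivisor M → ∀ vQ : (thetaIndexOfInitial D).VQ,
    Set ((logShellsOfInitialDH D logvK).Packet j.1 vQ))
  (n : ℤ) {HT : Type} {LogLink : HT → HT → Type} {IsFull : ∀ {s t : HT}, LogLink s t → Prop}
  (lat : LGPGaussianLogThetaLattice LogLink IsFull)
  {Frd : Type} {IsoF : Frd → Frd → Type} {Ob : Frd → Type} {realify : Frd → Frd} {Strip : Type}
  {IsoS : Strip → Strip → Type}
  {Mv : ∀ v : (thetaIndexOfInitial D).V, v ∈ (thetaIndexOfInitial D).Vbad → Type} [∀ v h, Monoid (Mv v h)]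
  (sig : GlobalLGPFrobenioidSignature (thetaIndexOfInitial D).lstar (thetaIndexOfInitial D).V
    (· ∈ (thetaIndexOfInitial D).Vbad) Frd IsoF Ob realify Strip IsoS Mv)
  (split : SplittingMonoids Mv) {ObΔ : Type}
  {N : ∀ v : (thetaIndexOfInitial D).V, v ∈ (thetaIndexOfInitial D).Vbad → Type} [∀ v h, Monoid (N v h)]
  (qData : QPilotData ObΔ N)
  (htq0 : ∀ (u : FinitePlace ℚ) (x : (thetaIndexOfInitial D).Fibre (Val.non u)),
    tqM D (ratChar u) u (natCast_ratChar_mem u) r x ≠ 0)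
  (Sq : Finset (FinitePlace ℚ))
  (htq1 : ∀ (u : FinitePlace ℚ) (x : (thetaIndexOfInitial D).Fibre (Val.non u)), u ∉ Sq →
    ‖tqM D (ratChar u) u (natCast_ratChar_mem u) r x‖ = 1)
  (x₀ : ∀ u : FinitePlace ℚ, (thetaIndexOfInitial D).Fibre (Val.non u))
  (ϖ : ∀ u : FinitePlace ℚ, (kOfM D (ratChar u) u (natCast_ratChar_mem u) (x₀ u))ˣ) (hϖ : ∀ u, IsUniformizer (ϖ u))
  (Dx : FinitePlace ℚ → ℕ)
  (hD : ∀ u, differentOrd (ratChar u) (kOfM D (ratChar u) u (natCast_ratChar_mem u) (x₀ u)) =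
    (Dx u : ℝ) / absRamificationIdx (ratChar u) (kOfM D (ratChar u) u (natCast_ratChar_mem u) (x₀ u)))
  (cin cout : ∀ u : FinitePlace ℚ, kOfM D (ratChar u) u (natCast_ratChar_mem u) (x₀ u))
  (hin : ∀ u (o : kOfM D (ratChar u) u (natCast_ratChar_mem u) (x₀ u)), ‖o‖ ≤ 1 →
    cin u * o ∈ logUnits (kOfM D (ratChar u) u (natCast_ratChar_mem u) (x₀ u)))
  (hmax : ∀ u, ∃ (ϖ' : (kOfM D (ratChar u) u (natCast_ratChar_mem u) (x₀ u))ˣ)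
    (w : kOfM D (ratChar u) u (natCast_ratChar_mem u) (x₀ u)),
    IsUniformizer ϖ' ∧ w ∉ logUnits (kOfM D (ratChar u) u (natCast_ratChar_mem u) (x₀ u)) ∧
      ‖w‖ * ‖(ϖ' : kOfM D (ratChar u) u (natCast_ratChar_mem u) (x₀ u))‖ ≤ ‖cin u‖)
  (houtΛ : ∀ u, cout u ∈ logUnits (kOfM D (ratChar u) u (natCast_ratChar_mem u) (x₀ u)))
  (hdom : ∀ u, ∀ z ∈ logUnits (kOfM D (ratChar u) u (natCast_ratChar_mem u) (x₀ u)), ‖z‖ ≤ ‖cout u‖)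
  (Rin Rout : FinitePlace ℚ → ℤ)
  (hRin : ∀ u, ‖cin u‖ = ‖(ϖ u : kOfM D (ratChar u) u (natCast_ratChar_mem u) (x₀ u))‖ ^ Rin u)
  (hRout : ∀ u, ‖cout u‖ = ‖(ϖ u : kOfM D (ratChar u) u (natCast_ratChar_mem u) (x₀ u))‖ ^ Rout u)
  (mq : FinitePlace ℚ → ℤ)
  (hq : ∀ u, ‖tqM D (ratChar u) u (natCast_ratChar_mem u) r (x₀ u)‖ =
    ‖(ϖ u : kOfM D (ratChar u) u (natCast_ratChar_mem u) (x₀ u))‖ ^ mq u)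

include hϖ hD hin hmax houtΛ hdom hRin hRout hq in
/-- **OWN IDELES, `[F_mod:ℚ] = 1`: THE LICENCE DECIDED EXACTLY** — part 3's `licence_settingPrVolSharpM_tOfIdeleData_iff_orders_of_forall_eq`
with the singleton hypothesis discharged: `Licence ⟺ ∀ u i, e_u·(((i+1)²·m_q(u) − (i+1)·D_u − (i+2)·R_in(u)) / e_u) + (i+2)·R_out(u) ≤ m_q(u)`.
[cite: Mochizuki2012, IUTchIII Cor. 3.12 p. 173–174, Step (xi-f) p. 184; IUTchI Def. 3.1 (b)(e) p. 61–62] [cite: DupuyHilado2025, §3.4, §4.9, §4.12] -/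
theorem licence_settingPrVolSharpM_tOfIdeleData_iff_orders_of_finrank_eq_one (hF : Module.finrank ℚ (fieldOfModuli E) = 1) :
    Thm311ToCor312.Licence
        (settingPrVolSharpM D hlog (tOfIdeleData D r) (fun u x => tqM D (ratChar u) u (natCast_ratChar_mem u) r x) M archPk archSub
          Ψ act Mmod region n lat sig split qData htq0 Sq htq1) ↔
      ∀ (u : FinitePlace ℚ) (i : Fin (thetaIndexOfInitial D).lstar),
        (absRamificationIdx (ratChar u) (kOfM D (ratChar u) u (natCast_ratChar_mem u) (x₀ u)) : ℤ) *
            ((mq u * ((((i : ℕ) + 1) ^ 2 : ℕ) : ℤ) - ((i : ℕ) + 1 : ℕ) * (Dx u : ℤ) - ((i : ℕ) + 2 : ℕ) * Rin u) /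
              (absRamificationIdx (ratChar u) (kOfM D (ratChar u) u (natCast_ratChar_mem u) (x₀ u)) : ℤ)) +
          ((i : ℕ) + 2 : ℕ) * Rout u ≤ mq u :=
  licence_settingPrVolSharpM_tOfIdeleData_iff_orders_of_forall_eq D hlog r M archPk archSub Ψ act Mmod region n lat sig split qData
    htq0 Sq htq1 x₀ (fun u x => fibre_eq_of_finrank_fieldOfModuli_eq_one D hF u x (x₀ u)) ϖ hϖ Dx hD cin cout hin hmax houtΛ hdom
    Rin Rout hRin hRout mq hq

include hϖ hD hin hmax houtΛ hdom hRin hRout hq in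
/-- **OWN IDELES, RATIONAL `j`-INVARIANT: THE LICENCE DECIDED EXACTLY** — the form the R-W WINDOW-TABLE's genuine M rows (Frey / known
abc-triple data, `j_E ∈ ℚ`) consume: `Licence ⟺ ∀ u i, e_u·(((i+1)²·m_q(u) − (i+1)·D_u − (i+2)·R_in(u)) / e_u) + (i+2)·R_out(u) ≤ m_q(u)`,
ONE integer `m_q(u)` per bad member (`m_q = 0` elsewhere, automatic by `orders_predicate_of_exponents_zero`) and the local type of the one
completion over each prime. [cite: Mochizuki2012, IUTchIII Cor. 3.12 p. 173–174, Step (xi-f) p. 184; IUTchI Def. 3.1 (b)(e) p. 61–62]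
[cite: DupuyHilado2025, §3.3, §3.4, §4.9, §4.12] -/
theorem licence_settingPrVolSharpM_tOfIdeleData_iff_orders_of_j_mem_range (hj : E.j ∈ Set.range (algebraMap ℚ F)) :
    Thm311ToCor312.Licence
        (settingPrVolSharpM D hlog (tOfIdeleData D r) (fun u x => tqM D (ratChar u) u (natCast_ratChar_mem u) r x) M archPk archSub
          Ψ act Mmod region n lat sig split qData htq0 Sq htq1) ↔
      ∀ (u : FinitePlace ℚ) (i : Fin (thetaIndexOfInitial D).lstar),
        (absRamificationIdx (ratChar u) (kOfM D (ratChar u) u (natCast_ratChar_mem u) (x₀ u)) : ℤ) *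
            ((mq u * ((((i : ℕ) + 1) ^ 2 : ℕ) : ℤ) - ((i : ℕ) + 1 : ℕ) * (Dx u : ℤ) - ((i : ℕ) + 2 : ℕ) * Rin u) /
              (absRamificationIdx (ratChar u) (kOfM D (ratChar u) u (natCast_ratChar_mem u) (x₀ u)) : ℤ)) +
          ((i : ℕ) + 2 : ℕ) * Rout u ≤ mq u :=
  licence_settingPrVolSharpM_tOfIdeleData_iff_orders_of_forall_eq D hlog r M archPk archSub Ψ act Mmod region n lat sig split qData
    htq0 Sq htq1 x₀ (fun u x => fibre_eq_of_j_mem_range D hj u x (x₀ u)) ϖ hϖ Dx hD cin cout hin hmax houtΛ hdom Rin Rout hRin hRout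
    mq hq

end Own

end Summit.ABC.IUTFork.Thm311.Real

end
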